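import Summits.ABC.IUTFork.Thm311LinkSmall
import Mathlib.CategoryTheory.InducedCategory
import Mathlib.CategoryTheory.Equivalence
import HarnessLib

/-!
# [IUTchIII] Theorem 3.11 in the author's terms, J2b: the small model IS the full subcategory on the family (equivalence of categories)

Record-only file (D-0012) of the abc-iut cell (seat abc-iut-c312-1); TAKES NO SIDE. PROOF of the claim in J2's
(`Thm311LinkSmall`) docstring that the small model `SmallFamily obj` (objects `I`, morphisms `Shrink (obj i ⟶ obj j)`) of a family
`obj : I → C` in a locally `0`-small category is EQUIVALENT to the full subcategory of `C` on the family — so that every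
categorical clause of the typed Theorem 3.11 (iii) (full poly-isomorphisms, "stabilized", "equivariant", (IPL), the (SHE)-loop)
transfers between the real frame of universe `≥ 1` and D's universe-`0` `LinkData` without loss:
* `SmallFamily.toAmbient : SmallFamily obj ⥤ C` — the realization functor (`i ↦ obj i`, morphisms read through `equivShrink`),
  FULLY FAITHFUL (`Full`, `Faithful` instances); J2's transports are its action on isomorphisms
  (`toAmbient_mapIso_isoToSmall`, `isoOfSmall_eq_mapIso`);
* `SmallFamily.toInduced : SmallFamily obj ⥤ InducedCategory C obj` — identity on objects onto `Mathlib`'s induced (full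
  sub)category on the family: full, faithful, essentially surjective, hence an EQUIVALENCE (`Functor.IsEquivalence`), and
  `toInduced ⋙ inducedFunctor obj = toAmbient`.
Elementary category theory; nothing of [IUTchIII] is read or asserted here. [folklore]
-/

noncomputable section

namespace Summit.ABC.IUTFork.Thm311.SmallFamily

open CategoryTheory

universe v u

variable {I : Type} {C : Type u} [Category.{v} C] (obj : I → C) [LocallySmall.{0} C]

/-- **The realization functor** of the small model: `i ↦ obj i`, a morphism `Shrink (obj i ⟶ obj j)` read back in `C`.
[folklore] -/
def toAmbient : SmallFamily obj ⥤ C where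
  obj i := obj i
  map f := (equivShrink _).symm f
  map_id i := symm_id i
  map_comp f g := symm_comp f g

/-- On objects the realization functor is the family. [folklore] -/
@[simp] theorem toAmbient_obj (i : SmallFamily obj) : (toAmbient obj).obj i = obj i := rfl

/-- On morphisms the realization functor is `equivShrink⁻¹`. [folklore] -/
@[simp] theorem toAmbient_map {i j : SmallFamily obj} (f : i ⟶ j) :
    (toAmbient obj).map f = (equivShrink (obj i ⟶ obj j)).symm f := rfl

/-- The realization functor is faithful. [folklore] -/
instance toAmbient_faithful : (toAmbient obj).Faithful :=
  ⟨fun h => (equivShrink _).symm.injective h⟩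

/-- The realization functor is full. [folklore] -/
instance toAmbient_full : (toAmbient obj).Full :=
  ⟨fun f => ⟨equivShrink _ f, by simp⟩⟩

variable {obj}

/-- J2's transport `isoToSmall` is the preimage of an isomorphism under the fully faithful realization functor: realizing
it gives the isomorphism back. [folklore] -/
@[simp] theorem toAmbient_mapIso_isoToSmall {i j : I} (e : obj i ≅ obj j) :
    (toAmbient obj).mapIso (isoToSmall e) = e :=
  Iso.ext (by simp)

/-- J2's transport `isoOfSmall` is the action of the realization functor on isomorphisms. [folklore] -/
theorem isoOfSmall_eq_mapIso {i j : I} (f : mk obj i ≅ mk obj j) : isoOfSmall f = (toAmbient obj).mapIso f :=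
  Iso.ext rfl

variable (obj)

/-- **Comparison with `Mathlib`'s induced (full sub)category on the family**: identity on objects, `equivShrink⁻¹` on
morphisms. [folklore] -/
def toInduced : SmallFamily obj ⥤ InducedCategory C obj where
  obj i := i
  map f := InducedCategory.homMk ((equivShrink _).symm f)
  map_id i := by ext; simp [symm_id]
  map_comp f g := by ext; simp [symm_comp]

/-- `toInduced` followed by `Mathlib`'s `inducedFunctor` is the realization functor. [folklore] -/
theorem toInduced_comp_inducedFunctor : toInduced obj ⋙ inducedFunctor obj = toAmbient obj := rfl

/-- `toInduced` is full. [folklore] -/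
instance toInduced_full : (toInduced obj).Full :=
  ⟨fun f => ⟨equivShrink _ f.hom, by ext; simp [toInduced]⟩⟩

/-- `toInduced` is faithful. [folklore] -/
instance toInduced_faithful : (toInduced obj).Faithful :=
  ⟨fun {i j} f g h => (equivShrink (obj i ⟶ obj j)).symm.injective (by
    simpa [toInduced] using congrArg InducedCategory.Hom.hom h)⟩

/-- `toInduced` is essentially surjective (it is the identity on objects). [folklore] -/
instance toInduced_essSurj : (toInduced obj).EssSurj :=
  ⟨fun Y => ⟨Y, ⟨Iso.refl _⟩⟩⟩

/-- **The small model is EQUIVALENT to the full subcategory of `C` on the family** (`Mathlib`'s `InducedCategory C obj`):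
`toInduced` is full, faithful and essentially surjective. This is the precise sense in which J2/J3 replace the real frame's
strips by their indices "without loss". [folklore] -/
instance toInduced_isEquivalence : (toInduced obj).IsEquivalence where

/-- The equivalence of categories `SmallFamily obj ≌ InducedCategory C obj`. [folklore] -/
def equivInduced : SmallFamily obj ≌ InducedCategory C obj := (toInduced obj).asEquivalence

end Summit.ABC.IUTFork.Thm311.SmallFamily

end
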